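import Summits.CriticalPhenomena.PercolationContinuityZ3.Theorems.PercNearOneGluingNoHeavyLowerTailThreePointIsoSexticEdgeNC
import Summits.CriticalPhenomena.PercolationContinuityZ3.Theorems.PercNearOneGluingNoHeavyLowerTailSuperTerminalPortPairs
import Summits.CriticalPhenomena.PercolationContinuityZ3.Theorems.PercNearOneGluingNoHeavyLowerTailSuperTerminalQuarticFace
import Summits.CriticalPhenomena.PercolationContinuityZ3.Theorems.PercNearOneGluingNoHeavyLowerTailSuperTerminalQuarticPendantCert
import HarnessLib

/-!
# The super-terminal rows along a PENDANT PORT: the port coordinates scale, `V4` and `P3_λ` pass from `x` to `c`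

Support file for crux `stmt-CriticalPhenomena-4575` (`NoHeavyLowerTail`), seat `prim-facecert` gen 22 (`--supports stmt-CriticalPhenomena-4575`);
memo `run/shared/lean/prim/prim-l12/prim-facecert/FINDING-gen22-PENDANT-PORT-TREE-CLASS.md` (§1 identities, §2 algebra).  No definitions, no sorries,
standard axioms.

Bond percolation `μ = prodBernoulli w` on a finite vertex type, root `s`, block partner `a`, singleton `b`, port `c`; `F = (s↔a) ∩ (s↔b)ᶜ`,
`Q = μ(F ∩ c∤{s,a,b})`, `A = μ(F ∩ c∤{s,a})`, `B = μ(F ∩ (c↔b)ᶜ)`, `C = μ(c∤{s,a,b})` (lane notation, `…SuperTerminalQuarticFace`,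
`…SuperTerminalPortPairs`); the super-terminal quartic law is `V4 : Q⁴ ≤ A²B²C`, the reverse-Harris rows are `P3_λ : μ(F)·μ(c↔T) ≤ λ·μ(F ∩ c↔T)`.

PENDANT PORT: every pair at `c` other than `e = cx` has weight `0`.  Then (`pendant_coordinates`), with `r = w e`, `μ₀ = prodBernoulli w[e↦0]`
and the port-`x` coordinates `Qₓ, Aₓ, Bₓ, Cₓ` under `μ₀`,
  `Q_c = (1−r)·μ₀(F) + r·Qₓ`, `A_c = (1−r)·μ₀(F) + r·Aₓ`, `B_c = (1−r)·μ₀(F) + r·Bₓ`, `C_c = (1−r) + r·Cₓ`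
— in the normal form `u = P(c∼S|F)`, `v = P(c∼b|F)`, `w = P(c∼T)` this is `(u,v,w)_c = r·(u,v,w)_x`.  (One-pair pivot
`ThreePointIsoSexticEdgeNC.real_update_eq`; under `μ₀` the port is a.s. isolated, `SuperTerminalPortPairs.ae_notMem_of_weight_eq_zero`, and after
inserting `e` at an isolated `c`, `c ↔ t ⟺ x ↔ t` while `s ↔ a`, `s ↔ b` are unchanged, `ThreePointIsoSexticEdgeNC.reachable_insert_iff`.)
* `superTerminalQuartic_pendant` — **`V4` for the port `x` under `w[e↦0]` ⟹ `V4` for the port `c` under `w`**: the `V4` region is star-shaped,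
  `pendant_alg` (human proof: `h(r) = (1−rσ)⁴/((1−ru)(1−rv))²` is convex since `h″/h = 2p²+2q²−4m²+4(2m−p−q)²` with `p+q ≤ m`; kernel proof: the
  exact chord-gap certificate `…SuperTerminalQuarticPendantCert.chord_gap_nonneg`).
* `p3lam_pendant` — the same transfer for every row `P3_λ` (linear in the coordinates: `μ_w(F) = μ₀(F)`, `μ_w(c↔T) = r·μ₀(x↔T)`,
  `μ_w(F ∩ c↔T) = r·μ₀(F ∩ x↔T)`).
* `superTerminalQuartic_isolatedPort`, `p3lam_isolatedPort` — the rows at a port without positive pairs (`Q = A = B = μ(F)`, `C = 1`).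
With the ∥-stability theorems (`…SuperTerminalP3LamGluing.p3lam_of_pieces`, l12-p1 g32; `…SuperTerminalQuarticGluing`, pending) these give the rows on
every graph whose port component in `G − {s,a,b}` is a tree (`…SuperTerminalPortTree`).
-/

namespace Summit.CriticalPhenomena.PercolationContinuityZ3.Theorems.SuperTerminalQuarticPendant

open MeasureTheory Set Filter
open Literature.Probability.Percolation Literature.Probability.LatticeModels
open Summit.CriticalPhenomena.PercolationContinuityZ3.Theorems.ThreePointIsoSexticEdgeNC (real_update_eq reachable_insert_iff)
open Summit.CriticalPhenomena.PercolationContinuityZ3.Theorems.SuperTerminalPortPairs (ae_notMem_of_weight_eq_zero)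
open scoped Classical

variable {V : Type*}

/-! ## An isolated vertex and a pendant pair: reachability -/

/-- If `c` has no open pair in `ω`, then `c` reaches only itself. [folklore] -/
theorem not_reachable_of_isolated {ω : BondConfig V} {c t : V} (hiso : ∀ y, y ≠ c → s(c, y) ∉ ω) (ht : t ≠ c) :
    ¬ (openGraph ω).Reachable c t := by
  rintro ⟨p⟩
  obtain ⟨d, -, hd1, hd2⟩ := p.exists_boundary_dart {y | y = c} rfl (by simpa using ht)
  have hadj := d.adj
  rw [openGraph_adj] at hadj
  have h1 : d.toProd.1 = c := hd1
  have h2 : d.toProd.2 ≠ c := hd2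
  rw [h1] at hadj
  exact hiso _ h2 hadj.1

/-- Inserting a pair `cx` at an isolated vertex `c` does not change reachability between vertices other than `c`. [folklore] -/
theorem reachable_insert_iff_of_isolated {ω : BondConfig V} {c x p q : V} (hiso : ∀ y, y ≠ c → s(c, y) ∉ ω)
    (hp : p ≠ c) (hq : q ≠ c) :
    (openGraph (insert s(c, x) ω)).Reachable p q ↔ (openGraph ω).Reachable p q := by
  rw [reachable_insert_iff]
  constructor
  · rintro (h | ⟨hpc, -⟩ | ⟨-, hcq⟩)
    · exact h
    · exact absurd hpc.symm (not_reachable_of_isolated hiso hp)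
    · exact absurd hcq (not_reachable_of_isolated hiso hq)
  · exact fun h => Or.inl h

/-- Inserting a pair `cx` at an isolated vertex `c` makes `c` reach exactly what `x` reaches. [folklore] -/
theorem reachable_insert_port_iff_of_isolated {ω : BondConfig V} {c x t : V} (hiso : ∀ y, y ≠ c → s(c, y) ∉ ω)
    (hx : x ≠ c) (ht : t ≠ c) :
    (openGraph (insert s(c, x) ω)).Reachable c t ↔ (openGraph ω).Reachable x t := by
  rw [reachable_insert_iff]
  constructor
  · rintro (h | ⟨-, hxt⟩ | ⟨hcx, -⟩)
    · exact absurd h (not_reachable_of_isolated hiso ht)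
    · exact hxt
    · exact absurd hcx (not_reachable_of_isolated hiso hx)
  · exact fun h => Or.inr (Or.inl ⟨SimpleGraph.Reachable.refl c, h⟩)

variable [Fintype V]

/-! ## The port coordinates of a pendant port -/

/-- If every pair at `c` other than `cx` has weight `0`, then under `w[cx ↦ 0]` the vertex `c` is almost surely isolated. [folklore] -/
theorem ae_isolated (w : Sym2 V → unitInterval) {c x : V} (hpend : ∀ y, y ≠ c → y ≠ x → (w s(c, y) : ℝ) = 0) :
    ∀ᵐ ω ∂(prodBernoulli (Function.update w s(c, x) 0)), ∀ y, y ≠ c → s(c, y) ∉ ω := by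
  filter_upwards [ae_notMem_of_weight_eq_zero (Function.update w s(c, x) 0)] with ω hω
  intro y hyc
  apply hω
  by_cases hyx : y = x
  · subst hyx; simp
  · rw [Function.update_of_ne (fun h => hyx ((Sym2.congr_right).1 h)), hpend y hyc hyx]

/-- **Pendant-port coordinates.**  If every pair at the port `c` other than `e = cx` has weight `0` (`c ∉ {s,a,b}`, `x ≠ c`), then with
`r = w e`, `μ₀ = prodBernoulli w[e ↦ 0]`, `F₀ = μ₀(F)` and the port-`x` coordinates `Qₓ, Aₓ, Bₓ, Cₓ` under `μ₀`:
`Q_c = (1−r)F₀ + r·Qₓ`, `A_c = (1−r)F₀ + r·Aₓ`, `B_c = (1−r)F₀ + r·Bₓ`, `C_c = (1−r) + r·Cₓ`. [this work] -/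
theorem pendant_coordinates (w : Sym2 V → unitInterval) {s a b c x : V} (hsc : s ≠ c) (hac : a ≠ c) (hbc : b ≠ c) (hxc : x ≠ c)
    (hpend : ∀ y, y ≠ c → y ≠ x → (w s(c, y) : ℝ) = 0) :
    (prodBernoulli w).real (openConn s a ∩ (openConn s b)ᶜ ∩ ((openConn c s)ᶜ ∩ (openConn c a)ᶜ ∩ (openConn c b)ᶜ) : Set (BondConfig V)) =
        (1 - (w s(c, x) : ℝ)) * (prodBernoulli (Function.update w s(c, x) 0)).real (openConn s a ∩ (openConn s b)ᶜ : Set (BondConfig V)) +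
          (w s(c, x) : ℝ) * (prodBernoulli (Function.update w s(c, x) 0)).real
            (openConn s a ∩ (openConn s b)ᶜ ∩ ((openConn x s)ᶜ ∩ (openConn x a)ᶜ ∩ (openConn x b)ᶜ) : Set (BondConfig V)) ∧
      (prodBernoulli w).real (openConn s a ∩ (openConn s b)ᶜ ∩ ((openConn c s)ᶜ ∩ (openConn c a)ᶜ) : Set (BondConfig V)) =
        (1 - (w s(c, x) : ℝ)) * (prodBernoulli (Function.update w s(c, x) 0)).real (openConn s a ∩ (openConn s b)ᶜ : Set (BondConfig V)) +
          (w s(c, x) : ℝ) * (prodBernoulli (Function.update w s(c, x) 0)).real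
            (openConn s a ∩ (openConn s b)ᶜ ∩ ((openConn x s)ᶜ ∩ (openConn x a)ᶜ) : Set (BondConfig V)) ∧
      (prodBernoulli w).real (openConn s a ∩ (openConn s b)ᶜ ∩ (openConn c b)ᶜ : Set (BondConfig V)) =
        (1 - (w s(c, x) : ℝ)) * (prodBernoulli (Function.update w s(c, x) 0)).real (openConn s a ∩ (openConn s b)ᶜ : Set (BondConfig V)) +
          (w s(c, x) : ℝ) * (prodBernoulli (Function.update w s(c, x) 0)).real
            (openConn s a ∩ (openConn s b)ᶜ ∩ (openConn x b)ᶜ : Set (BondConfig V)) ∧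
      (prodBernoulli w).real ((openConn c s)ᶜ ∩ (openConn c a)ᶜ ∩ (openConn c b)ᶜ : Set (BondConfig V)) =
        (1 - (w s(c, x) : ℝ)) + (w s(c, x) : ℝ) * (prodBernoulli (Function.update w s(c, x) 0)).real
            ((openConn x s)ᶜ ∩ (openConn x a)ᶜ ∩ (openConn x b)ᶜ : Set (BondConfig V)) := by
  set e : Sym2 V := s(c, x) with he
  set μ₀ := prodBernoulli (Function.update w e 0) with hμ₀
  have hiso := ae_isolated w hpend
  -- pivot on `e`: `μ_w(E) = (1 - r) μ₀(E) + r μ₀({ω | insert e ω ∈ E})`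
  have piv : ∀ E : Set (BondConfig V), (prodBernoulli w).real E =
      (1 - (w e : ℝ)) * μ₀.real E + (w e : ℝ) * μ₀.real {ω | insert e ω ∈ E} := by
    intro E
    have h := real_update_eq w e (w e) E
    rwa [Function.update_eq_self] at h
  -- under `μ₀`: `c ↔ t` is null for `t ≠ c`, and after inserting `e`, `c ↔ t` iff `x ↔ t`; `s ↔ a`, `s ↔ b` unchanged
  have hct : ∀ t : V, t ≠ c → ((openConn c t : Set (BondConfig V))ᶜ : Set (BondConfig V)) =ᵐ[μ₀] (univ : Set (BondConfig V)) := by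
    intro t ht
    rw [eventuallyEq_set]
    filter_upwards [hiso] with ω hω
    simp only [mem_compl_iff, openConn, mem_setOf_eq, mem_univ, iff_true]
    exact not_reachable_of_isolated hω ht
  have hins_ct : ∀ t : V, t ≠ c →
      ({ω : BondConfig V | insert e ω ∈ (openConn c t : Set (BondConfig V))} : Set (BondConfig V)) =ᵐ[μ₀]
        (openConn x t : Set (BondConfig V)) := by
    intro t ht
    rw [eventuallyEq_set]
    filter_upwards [hiso] with ω hω
    simp only [mem_setOf_eq, openConn]
    rw [reachable_insert_port_iff_of_isolated hω hxc ht]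
  have hins_pq : ∀ p q : V, p ≠ c → q ≠ c →
      ({ω : BondConfig V | insert e ω ∈ (openConn p q : Set (BondConfig V))} : Set (BondConfig V)) =ᵐ[μ₀]
        (openConn p q : Set (BondConfig V)) := by
    intro p q hp hq
    rw [eventuallyEq_set]
    filter_upwards [hiso] with ω hω
    simp only [mem_setOf_eq, openConn]
    rw [reachable_insert_iff_of_isolated hω hp hq]
  -- set algebra for preimages under `insert e`
  have pre_inter : ∀ E₁ E₂ : Set (BondConfig V),
      ({ω : BondConfig V | insert e ω ∈ E₁ ∩ E₂} : Set (BondConfig V)) = {ω | insert e ω ∈ E₁} ∩ {ω | insert e ω ∈ E₂} := by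
    intro E₁ E₂; ext ω; simp
  have pre_compl : ∀ E₁ : Set (BondConfig V),
      ({ω : BondConfig V | insert e ω ∈ E₁ᶜ} : Set (BondConfig V)) = {ω | insert e ω ∈ E₁}ᶜ := by
    intro E₁; ext ω; simp
  have hsa := hins_pq s a hsc hac
  have hsb := (hins_pq s b hsc hbc).compl
  have hcs := (hins_ct s hsc).compl
  have hca := (hins_ct a hac).compl
  have hcb := (hins_ct b hbc).compl
  refine ⟨?_, ?_, ?_, ?_⟩
  · rw [piv, measureReal_congr (EventuallyEq.rfl.inter (((hct s hsc).inter (hct a hac)).inter (hct b hbc)))]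
    simp only [inter_univ]
    congr 2
    apply measureReal_congr
    simp only [pre_inter, pre_compl]
    exact (hsa.inter hsb).inter ((hcs.inter hca).inter hcb)
  · rw [piv, measureReal_congr (EventuallyEq.rfl.inter ((hct s hsc).inter (hct a hac)))]
    simp only [inter_univ]
    congr 2
    apply measureReal_congr
    simp only [pre_inter, pre_compl]
    exact (hsa.inter hsb).inter (hcs.inter hca)
  · rw [piv, measureReal_congr (EventuallyEq.rfl.inter (hct b hbc))]
    simp only [inter_univ]
    congr 2
    apply measureReal_congr
    simp only [pre_inter, pre_compl]
    exact (hsa.inter hsb).inter hcb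
  · rw [piv, measureReal_congr (((hct s hsc).inter (hct a hac)).inter (hct b hbc))]
    simp only [inter_univ, probReal_univ, mul_one]
    congr 2
    apply measureReal_congr
    simp only [pre_inter, pre_compl]
    exact (hcs.inter hca).inter hcb

/-! ## Algebra: the `V4` region is star-shaped under the pendant scaling -/

/-- **Pendant algebra.**  `0 ≤ Q ≤ A ≤ F`, `Q ≤ B ≤ F`, `A + B = F + Q`, `0 ≤ C`, `r ∈ [0,1]` and `Q⁴ ≤ A²B²C` imply
`((1−r)F + rQ)⁴ ≤ ((1−r)F + rA)² ((1−r)F + rB)² ((1−r) + rC)`.  (With `u = (F−A)/F`, `v = (F−B)/F`: the function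
`r ↦ (1−r(u+v))⁴/((1−ru)(1−rv))²` is convex, hence below its chord.) [this work] -/
theorem pendant_alg {F Q A B C r : ℝ} (hQ : 0 ≤ Q) (hQA : Q ≤ A) (hQB : Q ≤ B) (hAF : A ≤ F) (hBF : B ≤ F)
    (hsum : A + B = F + Q) (hC0 : 0 ≤ C) (hr0 : 0 ≤ r) (hr1 : r ≤ 1) (hV4 : Q ^ 4 ≤ A ^ 2 * B ^ 2 * C) :
    ((1 - r) * F + r * Q) ^ 4 ≤ ((1 - r) * F + r * A) ^ 2 * ((1 - r) * F + r * B) ^ 2 * ((1 - r) + r * C) := by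
  -- coordinates `v = A − Q`, `u = B − Q`; then `A = Q + v`, `B = Q + u`, `F = Q + u + v`
  obtain ⟨v, hv, hA'⟩ : ∃ v : ℝ, 0 ≤ v ∧ A = Q + v := ⟨A - Q, by linarith, by ring⟩
  obtain ⟨u, hu, hB'⟩ : ∃ u : ℝ, 0 ≤ u ∧ B = Q + u := ⟨B - Q, by linarith, by ring⟩
  have hF' : F = Q + u + v := by linarith
  subst hA' hB' hF'
  -- the exact certificate (`…SuperTerminalQuarticPendantCert`): the chord gap is nonnegative
  have hM : ((1 - r) * (Q + u + v) + r * Q) ^ 4 * ((Q + v) * (Q + u)) ^ 2 ≤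
      (((1 - r) * (Q + u + v) + r * (Q + v)) * ((1 - r) * (Q + u + v) + r * (Q + u))) ^ 2 *
        ((1 - r) * ((Q + v) * (Q + u)) ^ 2 + r * Q ^ 4) :=
    sub_nonneg.1 (SuperTerminalQuarticPendantCert.chord_gap_nonneg Q u v r hQ hu hv hr0 hr1)
  -- use `V4` at `x`: `r·Q⁴ ≤ r·(AB)²·C`
  have hV4' : (1 - r) * ((Q + v) * (Q + u)) ^ 2 + r * Q ^ 4 ≤ ((Q + v) * (Q + u)) ^ 2 * ((1 - r) + r * C) := by
    have h1 : r * Q ^ 4 ≤ r * ((Q + v) ^ 2 * (Q + u) ^ 2 * C) := mul_le_mul_of_nonneg_left hV4 hr0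
    nlinarith [h1]
  have hM' : ((1 - r) * (Q + u + v) + r * Q) ^ 4 * ((Q + v) * (Q + u)) ^ 2 ≤
      ((((1 - r) * (Q + u + v) + r * (Q + v)) ^ 2 * ((1 - r) * (Q + u + v) + r * (Q + u)) ^ 2 * ((1 - r) + r * C))) *
        ((Q + v) * (Q + u)) ^ 2 := by
    calc _ ≤ _ := hM
      _ ≤ (((1 - r) * (Q + u + v) + r * (Q + v)) * ((1 - r) * (Q + u + v) + r * (Q + u))) ^ 2 *
            (((Q + v) * (Q + u)) ^ 2 * ((1 - r) + r * C)) := mul_le_mul_of_nonneg_left hV4' (sq_nonneg _)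
      _ = _ := by ring
  by_cases hAB : 0 < (Q + v) * (Q + u)
  · exact le_of_mul_le_mul_right hM' (by positivity)
  · -- degenerate: `A = 0` or `B = 0`, hence `Q = 0` and one of `u, v` vanishes
    have hprod : (Q + v) * (Q + u) = 0 := le_antisymm (not_lt.1 hAB) (by positivity)
    clear hM hM' hV4' hV4 hAB
    have h1 : (1 - r) ^ 2 ≤ (1 - r) + r * C := by
      have e : (1 - r) + r * C - (1 - r) ^ 2 = r * (1 - r) + r * C := by ring
      have h0 : 0 ≤ r * (1 - r) + r * C := add_nonneg (mul_nonneg hr0 (sub_nonneg.2 hr1)) (mul_nonneg hr0 hC0)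
      linarith
    rcases mul_eq_zero.1 hprod with h | h
    · have hQ0 : Q = 0 := by linarith
      have hv0 : v = 0 := by linarith
      subst hQ0 hv0
      calc ((1 - r) * (0 + u + 0) + r * 0) ^ 4 = ((1 - r) * u) ^ 2 * u ^ 2 * (1 - r) ^ 2 := by ring
        _ ≤ ((1 - r) * u) ^ 2 * u ^ 2 * ((1 - r) + r * C) := mul_le_mul_of_nonneg_left h1 (by positivity)
        _ = _ := by ring
    · have hQ0 : Q = 0 := by linarith
      have hu0 : u = 0 := by linarith
      subst hQ0 hu0
      calc ((1 - r) * (0 + 0 + v) + r * 0) ^ 4 = ((1 - r) * v) ^ 2 * v ^ 2 * (1 - r) ^ 2 := by ring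
        _ ≤ ((1 - r) * v) ^ 2 * v ^ 2 * ((1 - r) + r * C) := mul_le_mul_of_nonneg_left h1 (by positivity)
        _ = _ := by ring

/-! ## The pendant lemma -/

/-- **`V4` along a pendant port.**  Let `c ∉ {s,a,b}`, `x ≠ c`, and suppose every pair at `c` other than `e = cx` has weight `0`.  If the
super-terminal quartic law `V4` holds for the port `x` under `w[e ↦ 0]` (the graph with `c` detached), then `V4` holds for the port `c` under `w`.
Proof: `pendant_coordinates` (the port coordinates of `c` are the mixture `(1−r)·(F,F,F,1) + r·(Qₓ,Aₓ,Bₓ,Cₓ)`, `r = w e`), the inclusion–exclusion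
`Aₓ + Bₓ = F + Qₓ` (`SuperTerminalQuarticFace.real_F_add`), and `pendant_alg`. [this work] -/
theorem superTerminalQuartic_pendant (w : Sym2 V → unitInterval) {s a b c x : V} (hsc : s ≠ c) (hac : a ≠ c) (hbc : b ≠ c)
    (hxc : x ≠ c) (hpend : ∀ y, y ≠ c → y ≠ x → (w s(c, y) : ℝ) = 0)
    (hV4x : (prodBernoulli (Function.update w s(c, x) 0)).real
        (openConn s a ∩ (openConn s b)ᶜ ∩ ((openConn x s)ᶜ ∩ (openConn x a)ᶜ ∩ (openConn x b)ᶜ) : Set (BondConfig V)) ^ 4 ≤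
      (prodBernoulli (Function.update w s(c, x) 0)).real
          (openConn s a ∩ (openConn s b)ᶜ ∩ ((openConn x s)ᶜ ∩ (openConn x a)ᶜ) : Set (BondConfig V)) ^ 2 *
      (prodBernoulli (Function.update w s(c, x) 0)).real (openConn s a ∩ (openConn s b)ᶜ ∩ (openConn x b)ᶜ : Set (BondConfig V)) ^ 2 *
      (prodBernoulli (Function.update w s(c, x) 0)).real ((openConn x s)ᶜ ∩ (openConn x a)ᶜ ∩ (openConn x b)ᶜ : Set (BondConfig V))) :
    (prodBernoulli w).real (openConn s a ∩ (openConn s b)ᶜ ∩ ((openConn c s)ᶜ ∩ (openConn c a)ᶜ ∩ (openConn c b)ᶜ) : Set (BondConfig V)) ^ 4 ≤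
      (prodBernoulli w).real (openConn s a ∩ (openConn s b)ᶜ ∩ ((openConn c s)ᶜ ∩ (openConn c a)ᶜ) : Set (BondConfig V)) ^ 2 *
      (prodBernoulli w).real (openConn s a ∩ (openConn s b)ᶜ ∩ (openConn c b)ᶜ : Set (BondConfig V)) ^ 2 *
      (prodBernoulli w).real ((openConn c s)ᶜ ∩ (openConn c a)ᶜ ∩ (openConn c b)ᶜ : Set (BondConfig V)) := by
  obtain ⟨eQ, eA, eB, eC⟩ := pendant_coordinates w hsc hac hbc hxc hpend
  set μ₀ := prodBernoulli (Function.update w s(c, x) 0) with hμ₀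
  set r : ℝ := (w s(c, x) : ℝ) with hr
  set F : ℝ := μ₀.real (openConn s a ∩ (openConn s b)ᶜ : Set (BondConfig V)) with hF
  set Q : ℝ := μ₀.real (openConn s a ∩ (openConn s b)ᶜ ∩ ((openConn x s)ᶜ ∩ (openConn x a)ᶜ ∩ (openConn x b)ᶜ) : Set (BondConfig V)) with hQ
  set A : ℝ := μ₀.real (openConn s a ∩ (openConn s b)ᶜ ∩ ((openConn x s)ᶜ ∩ (openConn x a)ᶜ) : Set (BondConfig V)) with hA
  set B : ℝ := μ₀.real (openConn s a ∩ (openConn s b)ᶜ ∩ (openConn x b)ᶜ : Set (BondConfig V)) with hB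
  set C : ℝ := μ₀.real ((openConn x s)ᶜ ∩ (openConn x a)ᶜ ∩ (openConn x b)ᶜ : Set (BondConfig V)) with hC
  rw [eQ, eA, eB, eC]
  have hsum : A + B = F + Q := by
    have h := SuperTerminalQuarticFace.real_F_add (Function.update w s(c, x) 0) s a b x
    rw [← hμ₀] at h
    linarith
  have hQ0 : 0 ≤ Q := measureReal_nonneg
  have hQA : Q ≤ A := measureReal_mono (fun ω hω => ⟨hω.1, hω.2.1⟩) (by finiteness)
  have hQB : Q ≤ B := measureReal_mono (fun ω hω => ⟨hω.1, hω.2.2⟩) (by finiteness)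
  have hAF : A ≤ F := measureReal_mono (fun ω hω => hω.1) (by finiteness)
  have hBF : B ≤ F := measureReal_mono (fun ω hω => hω.1) (by finiteness)
  have hC0 : 0 ≤ C := measureReal_nonneg
  have hr0 : 0 ≤ r := (w s(c, x)).2.1
  have hr1 : r ≤ 1 := (w s(c, x)).2.2
  have key := pendant_alg hQ0 hQA hQB hAF hBF hsum hC0 hr0 hr1 hV4x
  simpa only [mul_one] using key

/-! ## The reverse-Harris rows `P3_λ` along a pendant port (linear in the coordinates, hence trivially star-shaped) -/

/-- **`P3_λ` along a pendant port.**  Same setting as `superTerminalQuartic_pendant`; the row `μ(F)·μ(c↔T) ≤ λ·μ(F ∩ c↔T)` passes from the port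
`x` under `w[cx ↦ 0]` to the port `c` under `w`: by `pendant_coordinates`, `μ_w(F) = μ₀(F)`, `μ_w(c↔T) = r·μ₀(x↔T)` and
`μ_w(F ∩ c↔T) = r·μ₀(F ∩ x↔T)`. [this work] -/
theorem p3lam_pendant (w : Sym2 V → unitInterval) {s a b c x : V} (hsc : s ≠ c) (hac : a ≠ c) (hbc : b ≠ c)
    (hxc : x ≠ c) (hpend : ∀ y, y ≠ c → y ≠ x → (w s(c, y) : ℝ) = 0) {lam : ℝ}
    (hP3x : (prodBernoulli (Function.update w s(c, x) 0)).real (openConn s a ∩ (openConn s b)ᶜ : Set (BondConfig V)) *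
        (prodBernoulli (Function.update w s(c, x) 0)).real ((openConn x s)ᶜ ∩ (openConn x a)ᶜ ∩ (openConn x b)ᶜ : Set (BondConfig V))ᶜ ≤
      lam * (prodBernoulli (Function.update w s(c, x) 0)).real
        (openConn s a ∩ (openConn s b)ᶜ ∩ ((openConn x s)ᶜ ∩ (openConn x a)ᶜ ∩ (openConn x b)ᶜ)ᶜ : Set (BondConfig V))) :
    (prodBernoulli w).real (openConn s a ∩ (openConn s b)ᶜ : Set (BondConfig V)) *
        (prodBernoulli w).real ((openConn c s)ᶜ ∩ (openConn c a)ᶜ ∩ (openConn c b)ᶜ : Set (BondConfig V))ᶜ ≤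
      lam * (prodBernoulli w).real (openConn s a ∩ (openConn s b)ᶜ ∩ ((openConn c s)ᶜ ∩ (openConn c a)ᶜ ∩ (openConn c b)ᶜ)ᶜ : Set (BondConfig V)) := by
  obtain ⟨eQ, eA, eB, eC⟩ := pendant_coordinates w hsc hac hbc hxc hpend
  set μ₀ := prodBernoulli (Function.update w s(c, x) 0) with hμ₀
  set r : ℝ := (w s(c, x) : ℝ) with hr
  have hr0 : 0 ≤ r := (w s(c, x)).2.1
  -- `μ_w(F)`, `μ_w(c↔T)`, `μ_w(F ∩ c↔T)` in terms of the port-`x` quantities under `μ₀`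
  have hFc := SuperTerminalQuarticFace.real_F_add w s a b c
  have hFx := SuperTerminalQuarticFace.real_F_add (Function.update w s(c, x) 0) s a b x
  have hIc := SuperTerminalQuarticFace.real_F_inter_compl_cIso w s a b c
  have hIx := SuperTerminalQuarticFace.real_F_inter_compl_cIso (Function.update w s(c, x) 0) s a b x
  have hCc : (prodBernoulli w).real ((openConn c s)ᶜ ∩ (openConn c a)ᶜ ∩ (openConn c b)ᶜ : Set (BondConfig V))ᶜ =
      1 - (prodBernoulli w).real ((openConn c s)ᶜ ∩ (openConn c a)ᶜ ∩ (openConn c b)ᶜ : Set (BondConfig V)) :=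
    probReal_compl_eq_one_sub MeasurableSet.of_discrete
  have hCx : μ₀.real ((openConn x s)ᶜ ∩ (openConn x a)ᶜ ∩ (openConn x b)ᶜ : Set (BondConfig V))ᶜ =
      1 - μ₀.real ((openConn x s)ᶜ ∩ (openConn x a)ᶜ ∩ (openConn x b)ᶜ : Set (BondConfig V)) :=
    probReal_compl_eq_one_sub MeasurableSet.of_discrete
  rw [← hμ₀] at hFx hIx
  have eF : (prodBernoulli w).real (openConn s a ∩ (openConn s b)ᶜ : Set (BondConfig V)) =
      μ₀.real (openConn s a ∩ (openConn s b)ᶜ : Set (BondConfig V)) := by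
    rw [eQ, eA, eB] at hFc; linear_combination hFc - r * hFx
  have eT : (prodBernoulli w).real ((openConn c s)ᶜ ∩ (openConn c a)ᶜ ∩ (openConn c b)ᶜ : Set (BondConfig V))ᶜ =
      r * μ₀.real ((openConn x s)ᶜ ∩ (openConn x a)ᶜ ∩ (openConn x b)ᶜ : Set (BondConfig V))ᶜ := by
    rw [hCc, hCx, eC]; ring
  have eFT : (prodBernoulli w).real (openConn s a ∩ (openConn s b)ᶜ ∩ ((openConn c s)ᶜ ∩ (openConn c a)ᶜ ∩ (openConn c b)ᶜ)ᶜ : Set (BondConfig V)) =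
      r * μ₀.real (openConn s a ∩ (openConn s b)ᶜ ∩ ((openConn x s)ᶜ ∩ (openConn x a)ᶜ ∩ (openConn x b)ᶜ)ᶜ : Set (BondConfig V)) := by
    rw [hIc, hIx, eF, eQ]; ring
  rw [eF, eT, eFT]
  have := mul_le_mul_of_nonneg_left hP3x hr0
  nlinarith [this]

/-! ## An isolated port: the rows hold trivially -/

/-- If the port `c` has no positive pair at all, its coordinates are `Q = A = B = μ(F)` and `C = 1`
(stated through `pendant_coordinates` with `x := s`, where `r = w(cs) = 0`). [this work] -/
theorem coordinates_isolatedPort (w : Sym2 V → unitInterval) {s a b c : V} (hsc : s ≠ c) (hac : a ≠ c) (hbc : b ≠ c)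
    (hiso : ∀ y, y ≠ c → (w s(c, y) : ℝ) = 0) :
    (prodBernoulli w).real (openConn s a ∩ (openConn s b)ᶜ ∩ ((openConn c s)ᶜ ∩ (openConn c a)ᶜ ∩ (openConn c b)ᶜ) : Set (BondConfig V)) =
        (prodBernoulli (Function.update w s(c, s) 0)).real (openConn s a ∩ (openConn s b)ᶜ : Set (BondConfig V)) ∧
      (prodBernoulli w).real (openConn s a ∩ (openConn s b)ᶜ ∩ ((openConn c s)ᶜ ∩ (openConn c a)ᶜ) : Set (BondConfig V)) =
        (prodBernoulli (Function.update w s(c, s) 0)).real (openConn s a ∩ (openConn s b)ᶜ : Set (BondConfig V)) ∧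
      (prodBernoulli w).real (openConn s a ∩ (openConn s b)ᶜ ∩ (openConn c b)ᶜ : Set (BondConfig V)) =
        (prodBernoulli (Function.update w s(c, s) 0)).real (openConn s a ∩ (openConn s b)ᶜ : Set (BondConfig V)) ∧
      (prodBernoulli w).real ((openConn c s)ᶜ ∩ (openConn c a)ᶜ ∩ (openConn c b)ᶜ : Set (BondConfig V)) = 1 := by
  have hpend : ∀ y, y ≠ c → y ≠ s → (w s(c, y) : ℝ) = 0 := fun y hy _ => hiso y hy
  obtain ⟨eQ, eA, eB, eC⟩ := pendant_coordinates w hsc hac hbc hsc hpend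
  have h0 : (w s(c, s) : ℝ) = 0 := hiso s hsc
  rw [h0] at eQ eA eB eC
  refine ⟨?_, ?_, ?_, ?_⟩
  · rw [eQ]; ring
  · rw [eA]; ring
  · rw [eB]; ring
  · rw [eC]; ring

/-- **`V4` at an isolated port** (with equality: `μ(F)⁴ ≤ μ(F)²·μ(F)²·1`). [this work] -/
theorem superTerminalQuartic_isolatedPort (w : Sym2 V → unitInterval) {s a b c : V} (hsc : s ≠ c) (hac : a ≠ c) (hbc : b ≠ c)
    (hiso : ∀ y, y ≠ c → (w s(c, y) : ℝ) = 0) :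
    (prodBernoulli w).real (openConn s a ∩ (openConn s b)ᶜ ∩ ((openConn c s)ᶜ ∩ (openConn c a)ᶜ ∩ (openConn c b)ᶜ) : Set (BondConfig V)) ^ 4 ≤
      (prodBernoulli w).real (openConn s a ∩ (openConn s b)ᶜ ∩ ((openConn c s)ᶜ ∩ (openConn c a)ᶜ) : Set (BondConfig V)) ^ 2 *
      (prodBernoulli w).real (openConn s a ∩ (openConn s b)ᶜ ∩ (openConn c b)ᶜ : Set (BondConfig V)) ^ 2 *
      (prodBernoulli w).real ((openConn c s)ᶜ ∩ (openConn c a)ᶜ ∩ (openConn c b)ᶜ : Set (BondConfig V)) := by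
  obtain ⟨eQ, eA, eB, eC⟩ := coordinates_isolatedPort w hsc hac hbc hiso
  rw [eQ, eA, eB, eC]
  nlinarith [sq_nonneg ((prodBernoulli (Function.update w s(c, s) 0)).real (openConn s a ∩ (openConn s b)ᶜ : Set (BondConfig V)) ^ 2)]

/-- **`P3_λ` at an isolated port** (`μ(c ↔ T) = 0`, so the row reads `0 ≤ λ·μ(F ∩ c↔T)`; needs `λ ≥ 0`). [this work] -/
theorem p3lam_isolatedPort (w : Sym2 V → unitInterval) {s a b c : V} (hsc : s ≠ c) (hac : a ≠ c) (hbc : b ≠ c)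
    (hiso : ∀ y, y ≠ c → (w s(c, y) : ℝ) = 0) {lam : ℝ} (hlam : 0 ≤ lam) :
    (prodBernoulli w).real (openConn s a ∩ (openConn s b)ᶜ : Set (BondConfig V)) *
        (prodBernoulli w).real ((openConn c s)ᶜ ∩ (openConn c a)ᶜ ∩ (openConn c b)ᶜ : Set (BondConfig V))ᶜ ≤
      lam * (prodBernoulli w).real (openConn s a ∩ (openConn s b)ᶜ ∩ ((openConn c s)ᶜ ∩ (openConn c a)ᶜ ∩ (openConn c b)ᶜ)ᶜ : Set (BondConfig V)) := by
  obtain ⟨-, -, -, eC⟩ := coordinates_isolatedPort w hsc hac hbc hiso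
  have hCc : (prodBernoulli w).real ((openConn c s)ᶜ ∩ (openConn c a)ᶜ ∩ (openConn c b)ᶜ : Set (BondConfig V))ᶜ =
      1 - (prodBernoulli w).real ((openConn c s)ᶜ ∩ (openConn c a)ᶜ ∩ (openConn c b)ᶜ : Set (BondConfig V)) :=
    probReal_compl_eq_one_sub MeasurableSet.of_discrete
  rw [hCc, eC, sub_self, mul_zero]
  exact mul_nonneg hlam measureReal_nonneg

end Summit.CriticalPhenomena.PercolationContinuityZ3.Theorems.SuperTerminalQuarticPendant
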